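import Summits.CriticalPhenomena.PercolationContinuityZ3.Theorems.PercNearOneGluingNoHeavyLowerTailHullPortMarkerDominanceTools
import Literature.Probability.Percolation.TwoClusterConditionalAssociationProofs
import Literature.Probability.Percolation.TripodExchange
import HarnessLib
import HarnessLib.Audit.Tags

/-!
# The single-edge chain rule under a FROZEN conditioning: THEOREM (PAPER-2 track (ii): constants of the CSH family)

builds on p205010 (kernel theorem, internal audit signed; external expert review pending).  Support file (`--supports
stmt-CriticalPhenomena-4575`), seat `prim-consts-2` (gen 7); rows A6/A11 of `run/shared/lean/prim/consts/CONSTANTS.md`; memo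
`run/shared/lean/prim/consts/FROM-prim-consts-2-g7-ROW-SPLIT.md` §2.  No definitions, no named facts, no sorries; standard axioms.

The single-edge chain rule CR (`Consts.SingleEdgeChainRule`, OPEN) compares, along the source chain `S₁ = {x} ⊂ S₂ = {x,u} ⊂
S₃ = {x,u,v}`, the quantities `a_i = P(o ∈ C_{S_i} | S_i ↮ Y)`, `b_i = P(v ∈ C_{S_i} | S_i ↮ Y)` — each row under ITS OWN conditional
measure `μ( · | S_i ↮ Y)`: `(1 − b₁)(a₃ − a₂) ≤ (1 − b₂)(a₃ − a₁)` (concavity of the three points `(b_i, a_i)`, `b₃ = 1`).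
Exact numerics (this seat, gen 7, folder `work/explore/test_battery2.py`, ≈ 2 400 random weighted graphs `n ≤ 7`) show that the
SAME concavity statement with all three rows computed under ONE measure `ν_S = μ( · | S ↮ Y)` holds for
`S ∈ {∅, {x}, {v}, {x,v}, {u,o}, {x,u,v}, {x,u,o}, {x,v,o}, {x,u,v,o}}` and FAILS for `S ∈ {{u}, {o}, {x,u}, {x,o}, {u,v}, {v,o}}`
(and for a generic vertex): freezing the conditioning at `S = {x,u}` (the middle row's) breaks it, freezing it at `S = {x}` (the
first row's) does not.  This file PROVES the `S = {x}` case: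

* `Consts.singleEdgeChainRule_frozen` — **THEOREM**: with `D = {x ↮ Y}`,
  `μ(D ∩ {v ∉ C_x}) · [μ(D ∩ {o ∈ C_{xuv}}) − μ(D ∩ {o ∈ C_{xu}})] ≤ μ(D ∩ {v ∉ C_{xu}}) · [μ(D ∩ {o ∈ C_{xuv}}) − μ(D ∩ {o ∈ C_x})]`,
  i.e. `(1 − b₁)(a₃' − a₂') ≤ (1 − b₂')(a₃' − a₁)` with all primed quantities under `μ( · | x ↮ Y)`.  For `Y = ∅` this is
  `Consts.singleEdgeChainRule_of_isEmpty` (van den Berg–Häggström–Kahn's Theorem 1.3 for `C_v` given `v ↮ x`); in general it is the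
  same computation with the positive association of `C_v` under `μ( · | x ↮ Y ∪ {v})` — the BHK Theorem-1.5 pattern "condition on
  `C_x`, Harris off the cluster, Theorem 1.3 for the law of `C_x`", available in the tree as `HullPort.offCluster_pair_posCorrelation`
  (`Consts.reach_pair_posCorrelation_offCluster`: given `x ↮ Y ∪ {v}`, `{v ↔ o}` and `{v ↔ u}` are positively correlated).
So the whole difficulty of CR is the CHANGE of conditioning between the rows (`x ↮ Y` → `xu ↮ Y` → `xuv ↮ Y`), cf. the row-split
normal form of `PercNearOneGluingNoHeavyConstsChainRuleRowSplit.lean`.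
[cite: VandenbergHaggstromKahn2005, Thm. 1.3 (p. 6), Thm. 1.5 (p. 7) and pp. 7–8]
-/

noncomputable section

namespace Summit.CriticalPhenomena.PercolationContinuityZ3.Theorems

open MeasureTheory Set Literature.Probability.LatticeModels Literature.Probability.Percolation
open scoped Classical

namespace Consts

variable {V : Type*} [Fintype V]

/-- **Given `x ↮ X` with `v ∈ X`, the events `{v ↔ o}` and `{v ↔ u}` are positively correlated**:
`μ(D ∩ {v ↔ o}) · μ(D ∩ {v ↔ u}) ≤ μ(D) · μ(D ∩ {v ↔ o} ∩ {v ↔ u})`, `D = {x ↮ X}` (`x ∉ X`).  On `D` the cluster of `v` lives off the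
cluster of `x`, so this is `HullPort.offCluster_pair_posCorrelation` (condition on `C_x`; Harris in the fresh variables; van den
Berg–Häggström–Kahn Thm 1.3 for the law of `C_x` given `x ↮ X`) with the off-cluster statistics `1{v ↔ o}`, `1{v ↔ u}`.
[cite: VandenbergHaggstromKahn2005, Thm. 1.3 (p. 6) and pp. 7–8 — corollary] -/
theorem reach_pair_posCorrelation_offCluster (w : Sym2 V → unitInterval) {x v : V} {X : Set V} (hx : x ∉ X) (hv : v ∈ X)
    (o u : V) :
    (prodBernoulli w).real ({ω : BondConfig V | ∀ t ∈ X, ¬ (openGraph ω).Reachable x t} ∩ openConn v o) *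
        (prodBernoulli w).real ({ω : BondConfig V | ∀ t ∈ X, ¬ (openGraph ω).Reachable x t} ∩ openConn v u) ≤
      (prodBernoulli w).real {ω : BondConfig V | ∀ t ∈ X, ¬ (openGraph ω).Reachable x t} *
        (prodBernoulli w).real ({ω : BondConfig V | ∀ t ∈ X, ¬ (openGraph ω).Reachable x t} ∩ (openConn v o ∩ openConn v u)) := by
  classical
  set μ := prodBernoulli w with hμ
  set D : Set (BondConfig V) := {ω | ∀ t ∈ X, ¬ (openGraph ω).Reachable x t} with hD
  -- the two off-cluster statistics
  set H₁ : BondConfig V → ℝ := (openConn v o).indicator 1 with hH₁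
  set H₂ : BondConfig V → ℝ := (openConn v u).indicator 1 with hH₂
  have hmono : ∀ a : V, Monotone ((openConn v a).indicator (1 : BondConfig V → ℝ)) := by
    intro a ω ω' hle
    by_cases h : ω ∈ openConn v a
    · have h' : ω' ∈ openConn v a := (show (openGraph ω).Reachable v a from h).mono (BHK2006.openGraph_le hle)
      rw [indicator_of_mem h, indicator_of_mem h']; simp
    · rw [indicator_of_notMem h]; exact indicator_nonneg (fun _ _ => zero_le_one) _
  have hnn : ∀ a : V, ∀ ω, 0 ≤ (openConn v a).indicator (1 : BondConfig V → ℝ) ω :=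
    fun a ω => indicator_nonneg (fun _ _ => zero_le_one) _
  -- locality: on `D`, `v ↔ a` is decided off the cluster of `x`
  have hloc : ∀ a : V, ∀ ω : BondConfig V, (∀ t ∈ X, ¬ (openGraph ω).Reachable x t) →
      (openConn v a).indicator (1 : BondConfig V → ℝ)
          (ω \ {e | ∃ y ∈ e, y = x ∨ ∃ e' ∈ openEdgeCluster ω x, y ∈ e'}) =
        (openConn v a).indicator (1 : BondConfig V → ℝ) ω := by
    intro a ω hω
    have hxv : ¬ (openGraph ω).Reachable x v := hω v hv
    have ht : ¬ (v = x ∨ ∃ e ∈ openEdgeCluster ω x, v ∈ e) := by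
      rw [← reachable_iff_exists_mem_openEdgeCluster]; exact hxv
    have hC := BHK2006.openEdgeCluster_eq_sdiff_bar (ω := ω) (s := x) (t := v) rfl ht
    have hiff : (openGraph (ω \ {e | ∃ y ∈ e, y = x ∨ ∃ e' ∈ openEdgeCluster ω x, y ∈ e'})).Reachable v a ↔
        (openGraph ω).Reachable v a := by
      rw [reachable_iff_exists_mem_openEdgeCluster, reachable_iff_exists_mem_openEdgeCluster, ← hC]
    by_cases h : ω ∈ openConn v a
    · have h' : (ω \ {e | ∃ y ∈ e, y = x ∨ ∃ e' ∈ openEdgeCluster ω x, y ∈ e'}) ∈ openConn v a := hiff.2 h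
      rw [indicator_of_mem h, indicator_of_mem h']; simp
    · have h' : (ω \ {e | ∃ y ∈ e, y = x ∨ ∃ e' ∈ openEdgeCluster ω x, y ∈ e'}) ∉ openConn v a := fun h'' => h (hiff.1 h'')
      rw [indicator_of_notMem h, indicator_of_notMem h']
  have key := HullPort.offCluster_pair_posCorrelation w x X hx (fun _ => (1 : ℝ)) (fun _ => (1 : ℝ))
    (fun _ _ _ => le_rfl) (fun _ _ _ => le_rfl) (fun _ => zero_le_one) (fun _ => zero_le_one)
    H₁ H₂ (hmono o) (hmono u) (hnn o) (hnn u) (hloc o) (hloc u)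
  simp only [one_mul, hH₁, hH₂, TripodExchange.setIntegral_indicator_one_eq,
    TripodExchange.setIntegral_indicator_mul_indicator_eq] at key
  exact key

/-- **THEOREM — the single-edge chain rule under the frozen conditioning `μ( · | x ↮ Y)`.**  For every finite weighted graph,
vertices `x, u, v, o` and a set `Y`, with `D = {x ↮ Y}`:
`μ(D ∩ {x ↮ v}) · [μ(D ∩ {o ∈ C_{xuv}}) − μ(D ∩ {o ∈ C_{xu}})] ≤ μ(D ∩ {x ↮ v, u ↮ v}) · [μ(D ∩ {o ∈ C_{xuv}}) − μ(D ∩ {o ∈ C_x})]`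
(`{o ∈ C_S} = ⋃_{s ∈ S} {s ↔ o}`), i.e. the concavity `(1 − b₁)(a₃' − a₂') ≤ (1 − b₂')(a₃' − a₁)` of the three points `(b, a)` computed
under the single measure `μ( · | x ↮ Y)`.  Proof: `{o ∈ C_{xuv}} ∖ {o ∈ C_{xu}} = {v ↔ o, v ↮ x, v ↮ u}`, `{o ∈ C_{xuv}} ∖ {o ∈ C_x} ⊇
{v ↔ o, v ↮ x}`, and the positive correlation of `{v ↔ o}`, `{v ↔ u}` given `x ↮ Y ∪ {v}` (`Consts.reach_pair_posCorrelation_offCluster`).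
[cite: VandenbergHaggstromKahn2005, Thm. 1.3 (p. 6), pp. 7–8] -/
theorem singleEdgeChainRule_frozen (w : Sym2 V → unitInterval) (x u v o : V) (Y : Set V) :
    (prodBernoulli w).real ({ω : BondConfig V | ∀ y ∈ Y, ¬ (openGraph ω).Reachable x y} ∩
          {ω | ¬ (openGraph ω).Reachable x v}) *
        ((prodBernoulli w).real ({ω : BondConfig V | ∀ y ∈ Y, ¬ (openGraph ω).Reachable x y} ∩
              (openConn x o ∪ openConn u o ∪ openConn v o)) -
          (prodBernoulli w).real ({ω : BondConfig V | ∀ y ∈ Y, ¬ (openGraph ω).Reachable x y} ∩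
              (openConn x o ∪ openConn u o))) ≤
      (prodBernoulli w).real ({ω : BondConfig V | ∀ y ∈ Y, ¬ (openGraph ω).Reachable x y} ∩
          {ω | ¬ (openGraph ω).Reachable x v ∧ ¬ (openGraph ω).Reachable u v}) *
        ((prodBernoulli w).real ({ω : BondConfig V | ∀ y ∈ Y, ¬ (openGraph ω).Reachable x y} ∩
              (openConn x o ∪ openConn u o ∪ openConn v o)) -
          (prodBernoulli w).real ({ω : BondConfig V | ∀ y ∈ Y, ¬ (openGraph ω).Reachable x y} ∩ openConn x o)) := by
  classical
  set μ := prodBernoulli w with hμ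
  have hmeas : ∀ T : Set (BondConfig V), MeasurableSet T := fun _ => MeasurableSet.of_discrete
  set D : Set (BondConfig V) := {ω | ∀ y ∈ Y, ¬ (openGraph ω).Reachable x y} with hD
  set A1 : Set (BondConfig V) := openConn x o with hA1
  set A2 : Set (BondConfig V) := openConn x o ∪ openConn u o with hA2
  set A3 : Set (BondConfig V) := openConn x o ∪ openConn u o ∪ openConn v o with hA3
  set N1 : Set (BondConfig V) := {ω | ¬ (openGraph ω).Reachable x v} with hN1
  set N2 : Set (BondConfig V) := {ω | ¬ (openGraph ω).Reachable x v ∧ ¬ (openGraph ω).Reachable u v} with hN2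
  -- the frozen-avoidance event `D' = {x ↮ Y ∪ {v}} = D ∩ N1`
  set D' : Set (BondConfig V) := {ω | ∀ t ∈ insert v Y, ¬ (openGraph ω).Reachable x t} with hD'
  have hD'eq : D' = D ∩ N1 := by
    ext ω
    simp only [hD', hD, hN1, mem_setOf_eq, mem_insert_iff, forall_eq_or_imp, mem_inter_iff]
    tauto
  set Ov : Set (BondConfig V) := openConn v o with hOv
  set Uv : Set (BondConfig V) := openConn v u with hUv
  -- (1) `μ(D ∩ A3) − μ(D ∩ A2) = μ(D' ∩ Ov ∩ Uvᶜ)`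
  have hA23 : D ∩ A2 ⊆ D ∩ A3 := inter_subset_inter_right _ subset_union_left
  have hdiff32 : (D ∩ A3) \ (D ∩ A2) = D' ∩ (Ov \ Uv) := by
    rw [hD'eq]
    ext ω
    simp only [hA3, hA2, hN1, hOv, hUv, mem_sdiff, mem_union, mem_inter_iff, mem_setOf_eq, openConn, not_or, not_and]
    constructor
    · rintro ⟨⟨hDω, h3⟩, h2⟩
      have hxo : ¬ (openGraph ω).Reachable x o := (h2 hDω).1
      have huo : ¬ (openGraph ω).Reachable u o := (h2 hDω).2
      have hvo : (openGraph ω).Reachable v o := by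
        rcases h3 with (h | h) | h
        · exact absurd h hxo
        · exact absurd h huo
        · exact h
      exact ⟨⟨hDω, fun hxv => hxo (hxv.trans hvo)⟩, hvo, fun hvu => huo (hvu.symm.trans hvo)⟩
    · rintro ⟨⟨hDω, hxv⟩, hvo, hvu⟩
      refine ⟨⟨hDω, Or.inr hvo⟩, fun _ => ⟨fun hxo => ?_, fun huo => ?_⟩⟩
      · exact hxv (hxo.trans hvo.symm)
      · exact hvu (hvo.trans huo.symm)
  have e32 : μ.real (D ∩ A3) - μ.real (D ∩ A2) = μ.real (D' ∩ (Ov \ Uv)) := by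
    have h := measureReal_sdiff (μ := μ) hA23 (hmeas (D ∩ A2))
    rw [hdiff32] at h; exact h.symm
  -- (2) `μ(D ∩ A3) − μ(D ∩ A1) ≥ μ(D' ∩ Ov)`
  have hA13 : D ∩ A1 ⊆ D ∩ A3 := inter_subset_inter_right _ (fun ω h => Or.inl (Or.inl h))
  have hsub31 : D' ∩ Ov ⊆ (D ∩ A3) \ (D ∩ A1) := by
    rw [hD'eq]
    rintro ω ⟨⟨hDω, hxv⟩, hvo⟩
    refine ⟨⟨hDω, Or.inr hvo⟩, fun h => ?_⟩
    exact hxv ((show (openGraph ω).Reachable x o from h.2).trans (show (openGraph ω).Reachable v o from hvo).symm)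
  have e31 : μ.real (D' ∩ Ov) ≤ μ.real (D ∩ A3) - μ.real (D ∩ A1) := by
    have h := measureReal_sdiff (μ := μ) hA13 (hmeas (D ∩ A1))
    rw [← h]; exact measureReal_mono hsub31
  -- (3) `D ∩ N2 = D' ∩ Uvᶜ`
  have hN2eq : D ∩ N2 = D' \ Uv := by
    rw [hD'eq]
    ext ω
    simp only [hN1, hN2, hUv, mem_inter_iff, mem_setOf_eq, mem_sdiff, openConn]
    constructor
    · rintro ⟨hDω, hxv, huv⟩; exact ⟨⟨hDω, hxv⟩, fun h => huv h.symm⟩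
    · rintro ⟨⟨hDω, hxv⟩, hvu⟩; exact ⟨hDω, hxv, fun h => hvu h.symm⟩
  -- (4) two `sdiff` identities
  have eOv : μ.real (D' ∩ (Ov \ Uv)) = μ.real (D' ∩ Ov) - μ.real (D' ∩ (Ov ∩ Uv)) := by
    have hsub : D' ∩ (Ov ∩ Uv) ⊆ D' ∩ Ov := inter_subset_inter_right _ inter_subset_left
    have hset : (D' ∩ Ov) \ (D' ∩ (Ov ∩ Uv)) = D' ∩ (Ov \ Uv) := by
      ext ω; simp only [mem_sdiff, mem_inter_iff]; tauto
    rw [← hset, measureReal_sdiff hsub (hmeas _)]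
  have eN2 : μ.real (D' \ Uv) = μ.real D' - μ.real (D' ∩ Uv) := by
    have hset : D' \ (D' ∩ Uv) = D' \ Uv := by
      ext ω; simp only [mem_sdiff, mem_inter_iff]; tauto
    rw [← hset, measureReal_sdiff inter_subset_left (hmeas _)]
  -- degenerate case `x ∈ Y ∪ {v}`: the left factor vanishes
  by_cases hx : x ∈ insert v Y
  · have hD'0 : D' = ∅ := by
      ext ω
      simp only [hD', mem_setOf_eq, mem_empty_iff_false, iff_false, not_forall, not_not]
      exact ⟨x, hx, SimpleGraph.Reachable.refl _⟩
    have hL : μ.real (D ∩ N1) = 0 := by rw [← hD'eq, hD'0]; simp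
    rw [hL, zero_mul]
    exact mul_nonneg measureReal_nonneg (by linarith [e31, (measureReal_nonneg : 0 ≤ μ.real (D' ∩ Ov))])
  -- main case: positive correlation of `{v ↔ o}` and `{v ↔ u}` given `x ↮ Y ∪ {v}`
  have key := reach_pair_posCorrelation_offCluster w hx (mem_insert v Y) o u
  -- key : μ.real (D' ∩ Ov) * μ.real (D' ∩ Uv) ≤ μ.real D' * μ.real (D' ∩ (Ov ∩ Uv))
  change μ.real (D' ∩ Ov) * μ.real (D' ∩ Uv) ≤ μ.real D' * μ.real (D' ∩ (Ov ∩ Uv)) at key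
  rw [e32, hN2eq, eOv, eN2, ← hD'eq]
  have h1 : 0 ≤ μ.real (D' ∩ Ov) := measureReal_nonneg
  have h2 : 0 ≤ μ.real D' - μ.real (D' ∩ Uv) := by
    rw [← eN2]; exact measureReal_nonneg
  calc μ.real D' * (μ.real (D' ∩ Ov) - μ.real (D' ∩ (Ov ∩ Uv)))
      = μ.real D' * μ.real (D' ∩ Ov) - μ.real D' * μ.real (D' ∩ (Ov ∩ Uv)) := by ring
    _ ≤ μ.real D' * μ.real (D' ∩ Ov) - μ.real (D' ∩ Ov) * μ.real (D' ∩ Uv) := by linarith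
    _ = (μ.real D' - μ.real (D' ∩ Uv)) * μ.real (D' ∩ Ov) := by ring
    _ ≤ (μ.real D' - μ.real (D' ∩ Uv)) * (μ.real (D ∩ A3) - μ.real (D ∩ A1)) :=
        mul_le_mul_of_nonneg_left e31 h2

end Consts

end Summit.CriticalPhenomena.PercolationContinuityZ3.Theorems

end
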